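import Literature.NumberTheory.GaloisRepresentations.ContinuousCorestrictionTransfer
import Literature.GroupTheory.Transfer.TransferTransitivity
import HarnessLib

/-!
# Transitivity of the corestriction on `H¹` with trivial coefficients: `cor_{G/H'} ∘ cor_{H'/H} = cor_{G/H}`

Topic `NumberTheory/GaloisRepresentations`; namespace `Literature.NumberTheory.GaloisRepresentations`.
Theorems only (no definition, no named fact).  For open finite-index subgroups `H ≤ H' ≤ G` of a
topological group `G` acting TRIVIALLY on `X`, the tree's corestrictions on continuous `H¹`
(`cores`, relative `coresLe`, `ContinuousCorestriction.lean`) compose: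

* **`cores_coresLe_eq_cores_of_trivial` — `cor_{G/H'} (cor_{H'/H} x) = cor_{G/H} x`** for every
  `x ∈ H¹(H, X)`.

Proof: with trivial coefficients the corestriction of a continuous character is its transfer
(`cores_oneCocycleClass_eq_of_trivial`, `transferCocycle_apply_eq_toAdd_transfer`,
`ContinuousCorestrictionTransfer.lean`), and the transfer is transitive
(`Literature.GroupTheory.Transfer.transfer_transfer`, `TransferTransitivity.lean`, Serre *Local Fields*
VII §8).  For GENERAL coefficients the same identity is `cores_coresLe_eq_cores` below, by the double-coset
computation on cochains with the product system of representatives `ρ(q)σ(p)`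
(`Literature.GroupTheory.Transfer.prodSection_bijective`); the discrete-cohomology version is
`Literature.Algebra.Homology.cores_comp_cores`.

Honest framing: classical; nothing here bears on abc or takes a side on [IUTchIII] Cor. 3.12.

## References
* J.-P. Serre, *Local Fields* (1979), VII §7–§8. [SerreLocalFields1979]
* J.-P. Serre, *Galois Cohomology* (1997), I §2.4. [SerreGaloisCohomology1997]
-/

noncomputable section

open CategoryTheory Function

universe u v

namespace Literature.NumberTheory.GaloisRepresentations

open _root_.ContinuousCohomology

variable {R : Type u} [Ring R] [TopologicalSpace R]
variable {G : Type v} [Group G] [TopologicalSpace G] [IsTopologicalGroup G]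
variable (X : TopRep.{v} R G) {H H' : Subgroup G}

/-- **Transitivity of the corestriction on `H¹` (trivial coefficients)**: for open subgroups
`H ≤ H'` of finite index in `G` and `G` acting trivially on `X`,
`cor_{G/H'} ∘ cor_{H'/H} = cor_{G/H}` on `H¹(H, X)`. [cite: SerreLocalFields1979, VII §8] -/
theorem cores_coresLe_eq_cores_of_trivial (htriv : ∀ (g : G) (v : X), X.ρ g v = v) (h : H ≤ H')
    (hH : IsOpen (H : Set G)) (hH' : IsOpen (H' : Set G)) [Fintype (G ⧸ H)] [Fintype (G ⧸ H')]
    [Fintype (H' ⧸ H.subgroupOf H')] (x : continuousCohomology 1 (subgroupRep X H)) :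
    cores X H' hH' (coresLe X h hH x) = cores X H hH x := by
  haveI : H.FiniteIndex := Subgroup.finiteIndex_of_finite_quotient
  haveI : H'.FiniteIndex := Subgroup.finiteIndex_of_finite_quotient
  haveI : (H.subgroupOf H').FiniteIndex := Subgroup.finiteIndex_of_finite_quotient
  obtain ⟨f, rfl⟩ := oneCocycleClass_surjective _ x
  have htriv' : ∀ (g : H') (v : (subgroupRep X H' : TopRep R H')),
      (subgroupRep X H').ρ g v = v := fun g v => htriv g v
  -- `f` as a homomorphism `φ : H →* Multiplicative X`, and `φ' = φ ∘ (H.subgroupOf H' ≃ H)`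
  let φ : H →* Multiplicative X :=
    { toFun := fun a => Multiplicative.ofAdd (f.1 a)
      map_one' := by rw [contOneCocycles.apply_one]; rfl
      map_mul' := fun a b => by rw [subgroup_cocycle_mul, htriv]; rfl }
  let φ' : H.subgroupOf H' →* Multiplicative X :=
    φ.comp (Subgroup.subgroupOfEquivOfLe h).toMonoidHom
  -- a continuous cocycle `Ψ` of `G` with values `Ver_{G/H}(φ)`
  obtain ⟨Ψ, hΨ⟩ := exists_contOneCocycles_apply_eq_transfer X H htriv hH f φ (fun _ => rfl)
  -- right-hand side: `cor_{G/H} [f] = [Ψ]`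
  rw [cores_oneCocycleClass_eq_of_trivial X H htriv hH f φ (fun _ => rfl) Ψ hΨ]
  -- the middle class: `cor_{H'/H} [f] = [f']`, `f'(h') = Ver_{H'/H}(φ')(h')`
  rw [coresLe_oneCocycleClass X h hH QuotientGroup.out_eq']
  set f' := transferCocycle (subgroupRep X H') (H.subgroupOf H') (isOpen_subgroupOf H' hH)
    QuotientGroup.out_eq' (contOneCocycles.pullback (subgroupOfHom h)
      (Y := subgroupRep (subgroupRep X H') (H.subgroupOf H'))
      (TopRep.ofHom ⟨ContinuousLinearMap.id R X, fun _ => rfl⟩) f) with hf'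
  have hf'v : ∀ a : H', f'.1 a = Multiplicative.toAdd (MonoidHom.transfer φ' a) := fun a =>
    transferCocycle_apply_eq_toAdd_transfer (subgroupRep X H') (H.subgroupOf H') htriv'
      (isOpen_subgroupOf H' hH) QuotientGroup.out_eq' _ φ' (fun _ => rfl) a
  -- left-hand side: `cor_{G/H'} [f'] = [Ψ]` since `Ver_{G/H'}(Ver_{H'/H}(φ')) = Ver_{G/H}(φ)`
  refine cores_oneCocycleClass_eq_of_trivial X H' htriv hH' f' (MonoidHom.transfer φ')
    (fun a => by rw [hf'v a, ofAdd_toAdd]) Ψ fun g => ?_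
  rw [hΨ g]
  congr 2
  exact (Literature.GroupTheory.Transfer.transfer_transfer h φ).symm


/-! ### General coefficients: the double-coset computation on cochains -/

section General

open Literature.NumberTheory.EllipticCurves (schreierElt schreierElt_coe)
open Literature.GroupTheory.Transfer (section_conj_mem prodSection_bijective)

variable {R : Type u} [Ring R] [TopologicalSpace R]
variable {G : Type v} [Group G] [TopologicalSpace G] [IsTopologicalGroup G]
variable (X : TopRep.{v} R G) {H H' : Subgroup G}

/-- **Transitivity of the corestriction on continuous `H¹`, arbitrary coefficients**: for open
subgroups `H ≤ H'` of finite index in `G` and any topological `G`-module `X`,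
`cor_{G/H'} ∘ cor_{H'/H} = cor_{G/H}` on `H¹(H, X)`.  On cochains, with sections `ρ` of `G → G/H'`,
`σ` of `H' → H'/H` and the product section `ρ(q)σ(p)` of `G → G/H` (a bijection
`G/H' × H'/H ≃ G/H`, `prodSection_bijective`), the `(q, p)` summand of `cor_{G/H} f (g)` is
`ρ(gq)σ(h_q p) • f(σ(h_q p)⁻¹ h_q σ(p))`, `h_q = ρ(gq)⁻¹ g ρ(q)`, which is the `(q, p)` summand of the
iterated transfer. [cite: SerreGaloisCohomology1997, I §2.4] -/
theorem cores_coresLe_eq_cores (h : H ≤ H') (hH : IsOpen (H : Set G)) (hH' : IsOpen (H' : Set G))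
    [Fintype (G ⧸ H)] [Fintype (G ⧸ H')] [Fintype (H' ⧸ H.subgroupOf H')]
    (x : continuousCohomology 1 (subgroupRep X H)) :
    cores X H' hH' (coresLe X h hH x) = cores X H hH x := by
  classical
  obtain ⟨f, rfl⟩ := oneCocycleClass_surjective _ x
  -- sections
  set ρ : G ⧸ H' → G := Quotient.out with hρdef
  have hρ : ∀ q : G ⧸ H', (ρ q : G ⧸ H') = q := Quotient.out_eq
  set σ : H' ⧸ H.subgroupOf H' → H' := Quotient.out with hσdef
  have hσ : ∀ p : H' ⧸ H.subgroupOf H', (σ p : H' ⧸ H.subgroupOf H') = p := Quotient.out_eq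
  -- the product section of `G → G/H`
  let Ψ : (G ⧸ H') × (H' ⧸ H.subgroupOf H') ≃ G ⧸ H :=
    Equiv.ofBijective _ (prodSection_bijective h hρ hσ)
  let π : G ⧸ H → G := fun c => ρ (Ψ.symm c).1 * (σ (Ψ.symm c).2 : G)
  have hπΨ : ∀ y, π (Ψ y) = ρ y.1 * (σ y.2 : G) := fun y => by
    simp only [π, Equiv.symm_apply_apply]
  have hπ : ∀ c, (π c : G ⧸ H) = c := fun c => by
    conv_rhs => rw [← Ψ.apply_symm_apply c]
    rfl
  -- compute the three corestrictions on cocycles with these sections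
  rw [cores_oneCocycleClass X H hH hπ, coresLe_oneCocycleClass X h hH hσ,
    cores_oneCocycleClass X H' hH' hρ]
  congr 1
  refine Subtype.ext (ContinuousMap.ext fun g => ?_)
  -- the `H'`-parts `h_q = ρ(gq)⁻¹ g ρ(q)`
  let hq : G ⧸ H' → H' := fun q => schreierElt H' hρ g q
  have hsmul : ∀ y : (G ⧸ H') × (H' ⧸ H.subgroupOf H'),
      g • Ψ y = Ψ (g • y.1, hq y.1 • y.2) := by
    rintro ⟨q, p⟩
    show g • ((ρ q * (σ p : G) : G) : G ⧸ H) =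
      ((ρ (g • q) * (σ (hq q • p) : G) : G) : G ⧸ H)
    rw [MulAction.Quotient.smul_coe, smul_eq_mul, QuotientGroup.eq]
    have hk := section_conj_mem hσ (hq q) p
    rw [Subgroup.mem_subgroupOf] at hk
    have h2 : (ρ (g • q) * (σ (hq q • p) : G))⁻¹ * (g * (ρ q * (σ p : G))) =
        (((σ (hq q • p))⁻¹ * hq q * σ p : H') : G) := by
      push_cast
      simp only [hq, schreierElt_coe]
      group
    rw [← inv_mem_iff, mul_inv_rev, inv_inv, h2]
    exact hk
  -- both sides as double sums
  rw [transferCocycle_apply, transferCocycle_apply, transferFun_apply, transferFun_apply]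
  rw [← Fintype.sum_equiv Ψ (fun y => X.ρ (π (g • Ψ y)) (f.1 (schreierElt H hπ g (Ψ y)))) _
    (fun y => rfl), Fintype.sum_prod_type]
  refine Fintype.sum_congr _ _ fun q => ?_
  rw [transferCocycle_apply, transferFun_apply, map_sum]
  refine Fintype.sum_congr _ _ fun p => ?_
  rw [subgroupRep_ρ_apply, ← ρ_mul_apply, hsmul, hπΨ]
  -- same group element acting; same argument of `f`
  congr 1
  change f.1 (subgroupOfHom h (schreierElt (H.subgroupOf H') hσ (hq q) p)) =
    f.1 (schreierElt H hπ g (Ψ (q, p)))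
  congr 1
  apply Subtype.ext
  rw [subgroupOfHom_apply_coe, schreierElt_coe, schreierElt_coe, hsmul, hπΨ, hπΨ]
  push_cast
  simp only [hq, schreierElt_coe]
  group

end General

end Literature.NumberTheory.GaloisRepresentations

end
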